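import Summits.NavierStokesRegularity.FluidComputer.ClayBlowupForcedLeraySupRate
import Literature.Analysis.FluidPDE.ForcedOseenResidualBound
import HarnessLib

/-!
# Tools for THE ZOOM WITH FORCE on the (C) type: near-maximum selection with ratio `θ ↑ 1`, the
# forced Oseen residual of a Clay blow-up, and the zoom sequence with its uniform window past the
# near-maximum time

Cell `ns-blowup`, seat `ns-blowup-ecbridge-2` (g10; the E–C endpoint theory seat). LABEL: E–C typing
(KERNEL — no named fact). WHAT THIS IS NOT: not Navier–Stokes evidence — bookkeeping on the TYPE
`ClayBlowup ν` (no inhabitant is claimed anywhere). Companion memo: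
`run/shared/lean/pub/ns-blowup/ecbridge2/ECBRIDGE-2-MEMO-9.md`.

## Content (Koch–Nadirashvili–Seregin–Šverák 2009, §6, the paragraph before Prop. 6.1, WITH force)

* `exists_near_max_ratio` — near-maximum selection with an arbitrary ratio `θ ∈ (0, 1)` (KNSS's
  `γ_k ↓ 1`): `R < ‖u(t₀, x₀)‖` and `θ ‖u(s, y)‖ ≤ ‖u(t₀, x₀)‖` on `(0, t₀]`;
* `ClayBlowup.norm_oseenResidual_le` — for EVERY Clay blow-up (`ν > 0`, any Clay force) there is
  `G ≥ 0` (the sup of the Leray projection of the force) with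
  `‖u(t,x) − e^{ν(t−s)Δ}u(s)(x) + B^ν_s(u,u)(t)(x)‖ ≤ (t − s) G` for all `0 ≤ s < t < T` and every `x`
  (the Literature bound `IsClassicalNSSolutionOn.norm_oseenResidual_le_forced` on the type);
* `ClayBlowup.exists_zoom_data` (`ν = 1`) — the zoom sequence: times `t_k ∈ (T/2, T)`, points `x_k`,
  magnitudes `M_k = ‖u(t_k, x_k)‖ ≥ k + 1` with `‖u‖ ≤ (1 + 1/(k+1)) M_k` on `(0, t_k]`, and — from
  g9's forced Leray window `forced_sup_window` and `velocity_unbounded` — a UNIFORM rescaled window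
  `δ > 0` past the near-maximum time: `t_k + δ/M_k² < T` and `‖u‖ ≤ 6 M_k` on `(0, t_k + δ/M_k²]`,
  together with the residual bound there.

References: Koch–Nadirashvili–Seregin–Šverák, Acta Math. 203 (2009), §6 [cite:
KochNadirashviliSereginSverak2009, §6 (6.2)–(6.3)]; J. Leray, Acta Math. 63 (1934), (3.16) [cite:
Leray1934, (3.16)]; C. L. Fefferman, Clay problem description, (C) [cite: FeffermanClay2006, (C)].
-/

noncomputable section

namespace Summit.NavierStokesRegularity.FluidComputer

open Set MeasureTheory Filter Topology Function
open scoped ENNReal NNReal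
open Literature.Analysis Literature.Analysis.FluidPDE
open Summit.NavierStokesRegularity.NavierStokesRegularity

/-! ## §1 Near-maximum selection with ratio `θ` -/

/-- **Near-maximum selection with ratio `θ ∈ (0, 1)`** (KNSS 2009, §6, the paragraph before Prop. 6.1:
"`M_k = |u(x_k, t_k)| ≥ N_k/γ_k`", `γ_k ↓ 1`). If `u` is bounded on `(0, T') × X` for every `T' < T`
but not on `(0, T) × X`, then for every `R` and every `θ ∈ (0, 1)` there are `t₀ ∈ (0, T)` and `x₀`
with `R < ‖u(t₀, x₀)‖` and `θ ‖u(s, y)‖ ≤ ‖u(t₀, x₀)‖` for all `s ∈ (0, t₀]`, all `y`.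
[cite: KochNadirashviliSereginSverak2009, §6 paragraph before Prop 6.1 (arXiv p. 11)] -/
theorem exists_near_max_ratio {X F : Type*} [NormedAddCommGroup F] {u : ℝ → X → F} {T : ℝ}
    (hbdd : ∀ T' < T, ∃ M : ℝ, ∀ t ∈ Ioo 0 T', ∀ x, ‖u t x‖ ≤ M)
    (hunb : ¬ ∃ M : ℝ, ∀ t ∈ Ioo 0 T, ∀ x, ‖u t x‖ ≤ M) (R : ℝ) {θ : ℝ} (hθ0 : 0 < θ)
    (hθ1 : θ < 1) :
    ∃ t₀ ∈ Ioo 0 T, ∃ x₀ : X, R < ‖u t₀ x₀‖ ∧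
      ∀ s ∈ Ioc 0 t₀, ∀ y, θ * ‖u s y‖ ≤ ‖u t₀ x₀‖ := by
  push Not at hunb
  obtain ⟨s₁, hs₁, x₁, hx₁⟩ := hunb (max R 0 / θ)
  set S : Set ℝ := {r | ∃ s ∈ Ioc 0 s₁, ∃ y, r = ‖u s y‖} with hS
  obtain ⟨B, hB⟩ := hbdd ((s₁ + T) / 2) (by linarith [hs₁.2])
  have hSbdd : BddAbove S := by
    refine ⟨B, ?_⟩
    rintro r ⟨s, hs, y, rfl⟩
    exact hB s ⟨hs.1, by linarith [hs.2, hs₁.2]⟩ y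
  have hmem : ‖u s₁ x₁‖ ∈ S := ⟨s₁, ⟨hs₁.1, le_rfl⟩, x₁, rfl⟩
  have hSne : S.Nonempty := ⟨_, hmem⟩
  set N : ℝ := sSup S with hN
  have hN1 : ‖u s₁ x₁‖ ≤ N := le_csSup hSbdd hmem
  have hR0 : 0 ≤ max R 0 / θ := div_nonneg (le_max_right _ _) hθ0.le
  have hNpos : 0 < N := lt_of_le_of_lt hR0 (hx₁.trans_le hN1)
  have hθN : θ * N < N := by nlinarith
  obtain ⟨r, ⟨t₀, ht₀, x₀, rfl⟩, hr⟩ := exists_lt_of_lt_csSup hSne hθN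
  refine ⟨t₀, ⟨ht₀.1, ht₀.2.trans_lt hs₁.2⟩, x₀, ?_, fun s hs y => ?_⟩
  · have h1 : max R 0 < θ * ‖u s₁ x₁‖ := by
      have := mul_lt_mul_of_pos_left hx₁ hθ0
      rwa [mul_div_cancel₀ _ hθ0.ne'] at this
    have h2 : θ * ‖u s₁ x₁‖ ≤ θ * N := mul_le_mul_of_nonneg_left hN1 hθ0.le
    exact (le_max_left R 0).trans_lt (h1.trans_le (h2.trans hr.le))
  · have hsS : ‖u s y‖ ∈ S := ⟨s, ⟨hs.1, hs.2.trans ht₀.2⟩, y, rfl⟩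
    exact (mul_le_mul_of_nonneg_left (le_csSup hSbdd hsS) hθ0.le).trans hr.le

namespace ClayBlowup

variable {ν : ℝ} (X : ClayBlowup ν)

/-! ## §2 The forced Oseen residual on the type -/

/-- **The forced Oseen residual of a Clay blow-up** (`ν > 0`, ANY Clay force; no named fact): there is
`G ≥ 0` — the sup of the Leray projection `P f` of the Clay force on `[0, T] × ℝ³` — such that for all
`0 ≤ s < t < T` and every `x`, `‖u(t, x) − e^{ν(t−s)Δ}u(s)(x) + B^ν_s(u, u)(t)(x)‖ ≤ (t − s) G`. The
Literature bound `IsClassicalNSSolutionOn.norm_oseenResidual_le_forced` on the closed sub-slab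
`[0, t]`, after re-gauging the Clay force to `P f` (`to_clayProjForce_of_le`); the type supplies the
finite energy and a qualitative bound there. [cite: LemarieRieusset2016, Thm. 6.1 with Prop. 6.5 (pp. 133–136)]
[cite: Tao2011, (8) and Cor. 11.1] -/
theorem norm_oseenResidual_le (hν : 0 < ν) :
    ∃ G : ℝ, 0 ≤ G ∧ ∀ s t : ℝ, 0 ≤ s → s < t → t < X.T → ∀ x,
      ‖X.u t x - UnboundedOperators.heatExtension (X.u s) (ν * (t - s)) x +
          oseenDuhamel ν s X.u X.u t x‖ ≤ (t - s) * G := by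
  have hT := X.T_pos
  have hfs := X.force_isSmoothSpaceTimeOn_Icc
  have hfd := X.force_hasUniformRapidDecayOn_Icc
  obtain ⟨G, hG0, hG⟩ := exists_norm_clayProjForce_le hT hfs hfd
  have hgc := continuous_uncurry_clayProjForce hT hfs hfd
  obtain ⟨G₂, hG₂, hg2⟩ := exists_eLpNorm_two_clayProjForce_le hT hfs hfd
  refine ⟨G, hG0, fun s t hs hst htT x => ?_⟩
  have ht0 : 0 < t := lt_of_le_of_lt hs hst
  -- the solution on `[0, t]`, driven by the projected force (some pressure `q`)
  obtain ⟨q, hre⟩ : ∃ q : ℝ → EuclideanSpace ℝ (Fin 3) → ℝ,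
      IsClassicalNSSolutionOn (Icc 0 t) ν (clayProjForce hT hfs hfd) X.u q :=
    ⟨_, (X.classical_Icc ht0 htT).to_clayProjForce_of_le hT hfs hfd htT.le⟩
  obtain ⟨B, hB⟩ := X.exists_norm_le hν htT
  have hM : 0 < max B 1 := lt_of_lt_of_le one_pos (le_max_right _ _)
  have hbd : ∀ τ ∈ Icc 0 t, ∀ y, ‖X.u τ y‖ ≤ max B 1 := fun τ hτ y =>
    (hB τ hτ y).trans (le_max_left _ _)
  exact hre.norm_oseenResidual_le_forced hν hgc (fun τ _ y => hG τ y)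
    (fun τ _ => isWeaklyDivFree_clayProjForce hT hfs hfd τ) hG₂ (fun τ _ => hg2 τ) (X.energy t htT)
    hM hbd hs hst le_rfl x

/-! ## §3 The zoom sequence with its uniform window (viscosity `1`) -/

/-- **THE ZOOM DATA OF A CLAY BLOW-UP WITH ITS CLAY FORCE** (`ν = 1`; Koch–Nadirashvili–Seregin–Šverák
2009, §6 (6.2)–(6.3), WITH force; no named fact). For every `X : ClayBlowup 1` there are a rescaled
window `δ > 0`, a residual constant `G ≥ 0`, times `t_k ∈ (T/2, T)` and points `x_k` such that, with
`M_k = ‖u(t_k, x_k)‖`: `M_k ≥ k + 1`; the near-maximum property `‖u(s, y)‖ ≤ (1 + 1/(k+1)) M_k` on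
`(0, t_k] × ℝ³`; the window `t_k + δ/M_k² < T` with `‖u(s, y)‖ ≤ 6 M_k` on `(0, t_k + δ/M_k²] × ℝ³`
(Leray's forced `L^∞` window `forced_sup_window` from the base time `t_k`, and `velocity_unbounded`
for the lifespan); and the forced Oseen residual bound `(s' − s) G` between all
`0 ≤ s < s' ≤ t_k + δ/M_k²`. [cite: KochNadirashviliSereginSverak2009, §6 (6.2)–(6.3) (arXiv p. 11)]
[cite: Leray1934, (3.16)] -/
theorem exists_zoom_data (X : ClayBlowup 1) :
    ∃ δ : ℝ, 0 < δ ∧ ∃ G : ℝ, 0 ≤ G ∧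
      ∃ (t : ℕ → ℝ) (x : ℕ → EuclideanSpace ℝ (Fin 3)), ∀ k : ℕ,
        t k ∈ Ioo 0 X.T ∧ X.T / 2 < t k ∧ (k : ℝ) + 1 ≤ ‖X.u (t k) (x k)‖ ∧
        (∀ s ∈ Ioc 0 (t k), ∀ y, ‖X.u s y‖ ≤ (1 + 1 / ((k : ℝ) + 1)) * ‖X.u (t k) (x k)‖) ∧
        t k + δ / ‖X.u (t k) (x k)‖ ^ 2 < X.T ∧
        (∀ s ∈ Ioc 0 (t k + δ / ‖X.u (t k) (x k)‖ ^ 2), ∀ y,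
          ‖X.u s y‖ ≤ 6 * ‖X.u (t k) (x k)‖) ∧
        (∀ s s' : ℝ, 0 ≤ s → s < s' → s' ≤ t k + δ / ‖X.u (t k) (x k)‖ ^ 2 → ∀ y,
          ‖X.u s' y - UnboundedOperators.heatExtension (X.u s) (1 * (s' - s)) y +
              oseenDuhamel 1 s X.u X.u s' y‖ ≤ (s' - s) * G) := by
  have hT := X.T_pos
  obtain ⟨c₀, hc₀, F, hF0, hwin⟩ := X.forced_sup_window one_pos
  obtain ⟨G, hG0, hres⟩ := X.norm_oseenResidual_le one_pos
  obtain ⟨B₁, hB₁⟩ := X.exists_norm_le one_pos (half_lt_self hT)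
  set δ : ℝ := c₀ / 9 with hδ
  have hδ0 : 0 < δ := by positivity
  -- boundedness on sub-slabs, unboundedness on `(0, T)`
  have hbdd : ∀ T' < X.T, ∃ M : ℝ, ∀ s ∈ Ioo 0 T', ∀ y, ‖X.u s y‖ ≤ M := by
    intro T' hT'
    obtain ⟨B, hB⟩ := X.exists_norm_le one_pos hT'
    exact ⟨B, fun s hs y => hB s ⟨hs.1.le, hs.2.le⟩ y⟩
  have hunb : ¬ ∃ M : ℝ, ∀ s ∈ Ioo 0 X.T, ∀ y, ‖X.u s y‖ ≤ M := by
    rintro ⟨M, hM⟩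
    obtain ⟨B₀, hB₀⟩ := X.exists_norm_le one_pos hT
    refine X.velocity_unbounded one_pos ⟨max M B₀, fun s hs y => ?_⟩
    rcases hs.1.eq_or_lt with h | h
    · rw [← h]; exact (hB₀ 0 ⟨le_rfl, le_rfl⟩ y).trans (le_max_right _ _)
    · exact (hM s ⟨h, hs.2⟩ y).trans (le_max_left _ _)
  -- the selection, with ratio `θ_k = (k+1)/(k+2)` and threshold `R_k`
  have hsel : ∀ k : ℕ, ∃ t₀ ∈ Ioo 0 X.T, ∃ x₀ : EuclideanSpace ℝ (Fin 3),
      max (max ((k : ℝ) + 1) (X.T * F)) (max B₁ 1) < ‖X.u t₀ x₀‖ ∧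
        ∀ s ∈ Ioc 0 t₀, ∀ y, ((k : ℝ) + 1) / ((k : ℝ) + 2) * ‖X.u s y‖ ≤ ‖X.u t₀ x₀‖ := fun k =>
    exists_near_max_ratio hbdd hunb _ (by positivity)
      ((div_lt_one (by positivity)).2 (by linarith))
  choose t ht x hR hnear using hsel
  refine ⟨δ, hδ0, G, hG0, t, x, fun k => ?_⟩
  -- ### the facts for the `k`-th zoom
  set M : ℝ := ‖X.u (t k) (x k)‖ with hM
  have hk1 : (k : ℝ) + 1 ≤ M :=
    ((le_max_left _ _).trans (le_max_left _ _)).trans (hR k).le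
  have hM1 : 1 ≤ M := ((le_max_right _ _).trans (le_max_right _ _)).trans (hR k).le
  have hM0 : 0 < M := lt_of_lt_of_le one_pos hM1
  have hTF : X.T * F ≤ M := ((le_max_right _ _).trans (le_max_left _ _)).trans (hR k).le
  have hB₁M : B₁ < M := lt_of_le_of_lt ((le_max_left _ _).trans (le_max_right _ _)) (hR k)
  -- `t_k > T/2`: on `[0, T/2]` the velocity is below `B₁ < M`
  have htk : X.T / 2 < t k := by
    by_contra h
    rw [not_lt] at h
    exact absurd (hB₁ (t k) ⟨(ht k).1.le, h⟩ (x k)) (not_le.2 hB₁M)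
  -- the near-maximum bound `‖u‖ ≤ (1 + 1/(k+1)) M ≤ 2M` on `(0, t_k]`
  have hθ : ∀ s ∈ Ioc 0 (t k), ∀ y, ‖X.u s y‖ ≤ (1 + 1 / ((k : ℝ) + 1)) * M := by
    intro s hs y
    have h := hnear k s hs y
    have hk0 : (0 : ℝ) < (k : ℝ) + 1 := by positivity
    have e : (1 + 1 / ((k : ℝ) + 1)) * M = M / (((k : ℝ) + 1) / ((k : ℝ) + 2)) := by
      field_simp
      ring
    rw [e, le_div_iff₀ (by positivity)]
    linarith
  have h2M : ∀ s ∈ Ioc 0 (t k), ∀ y, ‖X.u s y‖ ≤ 2 * M := by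
    intro s hs y
    refine (hθ s hs y).trans (mul_le_mul_of_nonneg_right ?_ hM0.le)
    have : 1 / ((k : ℝ) + 1) ≤ 1 := (div_le_one (by positivity)).2 (by linarith [k.cast_nonneg (α := ℝ)])
    linarith
  -- the window constant `K = 2M + (T − t_k) F ∈ [2M, 3M]`
  set K : ℝ := 2 * M + (X.T - t k) * F with hK
  have hKM : K ≤ 3 * M := by
    have : (X.T - t k) * F ≤ X.T * F :=
      mul_le_mul_of_nonneg_right (by linarith [(ht k).1]) hF0
    linarith
  have hK0 : 0 < K := by
    have : 0 ≤ (X.T - t k) * F := mul_nonneg (by linarith [(ht k).2]) hF0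
    linarith
  have hK2 : K ^ 2 ≤ 9 * M ^ 2 := by nlinarith
  have htkI : t k ∈ Ico 0 X.T := ⟨(ht k).1.le, (ht k).2⟩
  have hwk := hwin (t k) htkI (2 * M) (by positivity) (fun y => h2M (t k) ⟨(ht k).1, le_rfl⟩ y)
  -- the lifespan: `t_k + δ/M² < T`
  have hδM : δ / M ^ 2 = c₀ / (9 * M ^ 2) := by rw [hδ, div_div]
  have hlife : t k + δ / M ^ 2 < X.T := by
    by_contra hle
    rw [not_lt] at hle
    -- then the window covers `[t_k, T)` and `u` is bounded on `[0, T)`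
    have hlate : ∀ s ∈ Ico (t k) X.T, ∀ y, ‖X.u s y‖ ≤ 2 * K := by
      intro s hs y
      refine hwk s hs ?_ y
      have h1 : s - t k ≤ δ / M ^ 2 := by linarith [hs.2]
      calc K ^ 2 * (s - t k) ≤ 9 * M ^ 2 * (δ / M ^ 2) :=
            mul_le_mul hK2 h1 (by linarith [hs.1]) (by positivity)
        _ = c₀ * 1 := by rw [hδ]; field_simp
    obtain ⟨B₀, hB₀⟩ := X.exists_norm_le one_pos (ht k).2
    refine X.velocity_unbounded one_pos ⟨max B₀ (2 * K), fun s hs y => ?_⟩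
    rcases le_or_gt s (t k) with h | h
    · exact (hB₀ s ⟨hs.1, h⟩ y).trans (le_max_left _ _)
    · exact (hlate s ⟨h.le, hs.2⟩ y).trans (le_max_right _ _)
  -- the window bound `‖u‖ ≤ 6M` on `(0, t_k + δ/M²]`
  have h6M : ∀ s ∈ Ioc 0 (t k + δ / M ^ 2), ∀ y, ‖X.u s y‖ ≤ 6 * M := by
    intro s hs y
    rcases le_or_gt s (t k) with h | h
    · exact (h2M s ⟨hs.1, h⟩ y).trans (by linarith)
    · have hsI : s ∈ Ico (t k) X.T := ⟨h.le, lt_of_le_of_lt hs.2 hlife⟩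
      have hc : K ^ 2 * (s - t k) ≤ c₀ * 1 := by
        have h1 : s - t k ≤ δ / M ^ 2 := by linarith [hs.2]
        calc K ^ 2 * (s - t k) ≤ 9 * M ^ 2 * (δ / M ^ 2) :=
              mul_le_mul hK2 h1 (by linarith) (by positivity)
          _ = c₀ * 1 := by rw [hδ]; field_simp
      exact (hwk s hsI hc y).trans (by linarith)
  refine ⟨ht k, htk, hk1, hθ, hlife, h6M, fun s s' hs hss' hs' y => ?_⟩
  exact hres s s' hs hss' (lt_of_le_of_lt hs' hlife) y

end ClayBlowup

end Summit.NavierStokesRegularity.FluidComputer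

end
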